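import Literature.NumberTheory.LFunctions.DirichletLFunctionInverseBound
import Literature.NumberTheory.LFunctions.ZetaClassicalRegionBounds
import Mathlib.NumberTheory.Harmonic.ZetaAsymp
import HarnessLib

/-!
# Landau's method for `μ(n)χ(n)`: the hypotheses `ExcPsiData` for `1 + λ Re(w χ(n)) μ(n)`
# (Montgomery–Vaughan §11.3, Exercises 7–8)

Topic `Literature/NumberTheory/LFunctions`. Everything in this file is PROVED (theorems only).

To estimate the twisted Möbius sums `M(x, χ) = ∑_{n ≤ x} χ(n)μ(n)` (MV (11.39)) by the tree's
Landau engine with an exceptional zero (`ExceptionalZeroPsi.lean`,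
`Literature.NumberTheory.LFunctions.ExcPsiData` and `ExcPsiData.exists_psi_bound`), we apply it
to the NON-NEGATIVE sequences `Λ'(n) = 1 + λ Re(w χ(n)) μ(n)` (`|w| ≤ 1`, `0 < λ ≤ 1`), whose
Dirichlet series is

  `ζ(s) + (λ/2)(w/L(s, χ) + w̄/L(s, χ̄))`  (`LSeries_coeff_eq`; Mathlib: `L(χ, s)·L(χμ, s) = 1`),

so that `∑_{n ≤ x} Λ'(n) = ⌊x⌋ + λ Re(w M(x, χ))`, and `w = 1`, `w = −i` recover `M(x, χ)`.

* `exists_excPsiData_twist` — for `χ ≠ χ₀` mod `q`: with `λ = 1/(K log 4q + 1)` there are `F`,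
  `β`, `α` with `ExcPsiData Λ' F c C₀ (log q) β α`, `c, K, C₀` ABSOLUTE; either `α = 0` (no
  exceptional zero), or `χ` is quadratic, `β` is its real zero `> 1 − 2c₁/log 4q` and
  `α = −λRe(w)/L'(β, χ)` is the residue of `−λRe(w)/L(s, χ)` at `β` (`|α| ≤ 1` since
  `1/L'(β, χ) ≪ log 4q`, MV (11.10)). The holomorphic part is
  `F = ζ₀ + λRe(w)·dslope (1/g) β`, `g = L(s,χ)/(s − β)`, bounded by MV (11.7)/(11.10)
  (`DirichletZFR.exists_inv_LFunction_bounds`) and `ζ(s) − 1/(s−1) ≪ log(|t|+4)`.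
* `exists_excPsiData_principal` — for `χ = χ₀`: `1/L(s, χ₀) = ∏_{p ∣ q}(1 − p^{-s})^{-1}/ζ(s)`,
  giving `ExcPsiData Λ' F c (C₀q²) (log q) (1/2) 0` (`|∏_{p ∣ q}(1 − p^{-s})^{-1}| ≤ 4^{ω(q)} ≤ q²`).
* `exists_excPsiData_all` — both cases with common constants, and `ExcPsiData.weaken`.

The next files turn `ExcPsiData.exists_psi_bound` + Siegel's theorem into
`Literature.NumberTheory.LFunctions.MoebiusCharacterSumBound` (MV Exercise 8) and
`Literature.NumberTheory.LFunctions.SiegelWalfiszMoebius` (MV Exercise 13).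

## References

* H. L. Montgomery, R. C. Vaughan, *Multiplicative Number Theory I. Classical Theory*, CUP 2007,
  §11.3, Exercises 7–8 (p. 383) with Theorem 11.16 and Theorem 11.4 (`MontgomeryVaughan2007`).
* E. C. Titchmarsh, *The Theory of the Riemann Zeta-Function*, 2nd ed. (1986), Theorem 3.11,
  (3.11.7)–(3.11.8) (`Titchmarsh1986`).
-/

noncomputable section

open Complex Filter Topology Metric Set Finset
open scoped ArithmeticFunction.Moebius ComplexConjugate

namespace Literature.NumberTheory.LFunctions

namespace MoebiusTwist

/-! ## `ζ(s) − 1/(s − 1) ≪ log(|t| + 4)` near `σ = 1` -/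

/-- `‖ζ₀(s)‖ ≤ C log(|t| + 4)` for `σ ≥ 1 − c/log(|t| + 4)`, where `ζ₀(s) = ζ(s) − 1/(s − 1)`
(Mathlib's entire `riemannZeta₀`, value `γ` at `s = 1`); from the tree's
`ZetaClassicalRegion.exists_zeroFreeRegion_bounds` (Titchmarsh (3.11.7)).
[cite: Titchmarsh1986, Theorem 3.11 eq. (3.11.7) and (3.11.8)] -/
theorem exists_norm_riemannZeta₀_le :
    ∃ c : ℝ, 0 < c ∧ ∃ C : ℝ, 0 ≤ C ∧ ∀ s : ℂ, 1 - c / Real.log (|s.im| + 4) ≤ s.re →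
      ‖riemannZeta₀ s‖ ≤ C * Real.log (|s.im| + 4) := by
  obtain ⟨cbar, hcb0, -, C, hC0, hreg⟩ := ZetaClassicalRegion.exists_zeroFreeRegion_bounds
  refine ⟨4 * cbar, by positivity, 2 * C + ‖riemannZeta₀ 1‖, by positivity, fun s hs ↦ ?_⟩
  have hl3 : 1 < Real.log (|s.im| + 3) := ZetaClassicalRegion.one_lt_log_abs_add_three s.im
  have h34 : Real.log (|s.im| + 3) ≤ Real.log (|s.im| + 4) :=
    Real.log_le_log (by positivity) (by linarith)
  have hl4 : 1 ≤ Real.log (|s.im| + 4) := by linarith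
  have hγ := norm_nonneg (riemannZeta₀ 1)
  by_cases h1 : s = 1
  · subst h1
    calc ‖riemannZeta₀ 1‖ = ‖riemannZeta₀ 1‖ * 1 := (mul_one _).symm
      _ ≤ (2 * C + ‖riemannZeta₀ 1‖) * Real.log (|(1 : ℂ).im| + 4) :=
          mul_le_mul (by linarith) hl4 zero_le_one (by positivity)
  · have hreg' : 1 - 4 * cbar / Real.log (|s.im| + 3) ≤ s.re := by
      have : 4 * cbar / Real.log (|s.im| + 4) ≤ 4 * cbar / Real.log (|s.im| + 3) :=
        div_le_div_of_nonneg_left (by positivity) (by linarith) h34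
      linarith
    obtain ⟨-, hsub, -, -⟩ := hreg s h1 hreg'
    have hζ₀ : riemannZeta₀ s = riemannZeta s - 1 / (s - 1) := by
      rw [riemannZeta_eq_inv_sub_add h1, one_div]; ring
    rw [hζ₀]
    calc ‖riemannZeta s - 1 / (s - 1)‖ ≤ C * Real.log (|s.im| + 3) := hsub
      _ ≤ (2 * C + ‖riemannZeta₀ 1‖) * Real.log (|s.im| + 4) := by nlinarith

/-! ## The coefficients `1 + λ Re(w χ(n)) μ(n)` and their Dirichlet series -/

section Coeff

variable {q : ℕ} [NeZero q] (χ : DirichletCharacter ℂ q)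

omit [NeZero q] in
/-- `|Re(w χ(n) μ(n))| ≤ 1` for `|w| ≤ 1`. [folklore] -/
theorem abs_re_twist_le {w : ℂ} (hw : ‖w‖ ≤ 1) (n : ℕ) :
    |(w * χ (n : ZMod q) * (μ n : ℂ)).re| ≤ 1 := by
  refine (Complex.abs_re_le_norm _).trans ?_
  rw [norm_mul, norm_mul, Complex.norm_intCast]
  have h1 : ‖χ (n : ZMod q)‖ ≤ 1 := DirichletCharacter.norm_le_one χ _
  have h2 : |(μ n : ℝ)| ≤ 1 := by exact_mod_cast ArithmeticFunction.abs_moebius_le_one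
  calc ‖w‖ * ‖χ (n : ZMod q)‖ * |(μ n : ℝ)| ≤ 1 * 1 * 1 := by
        gcongr
    _ = 1 := by norm_num

omit [NeZero q] in
/-- `1 + λ Re(w χ(n)) μ(n) ≥ 0` for `0 ≤ λ ≤ 1`, `|w| ≤ 1`. [folklore] -/
theorem coeff_nonneg {w : ℂ} (hw : ‖w‖ ≤ 1) {lam : ℝ} (h0 : 0 ≤ lam) (h1 : lam ≤ 1) (n : ℕ) :
    0 ≤ 1 + lam * (w * χ (n : ZMod q) * (μ n : ℂ)).re := by
  have h := abs_re_twist_le χ hw n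
  have := neg_abs_le (w * χ (n : ZMod q) * (μ n : ℂ)).re
  nlinarith

omit [NeZero q] in
/-- `|1 + λ Re(w χ(n)) μ(n)| ≤ 2` for `0 ≤ λ ≤ 1`, `|w| ≤ 1`. [folklore] -/
theorem abs_coeff_le {w : ℂ} (hw : ‖w‖ ≤ 1) {lam : ℝ} (h0 : 0 ≤ lam) (h1 : lam ≤ 1) (n : ℕ) :
    |1 + lam * (w * χ (n : ZMod q) * (μ n : ℂ)).re| ≤ 2 := by
  have h := abs_re_twist_le χ hw n
  have h2 : |lam * (w * χ (n : ZMod q) * (μ n : ℂ)).re| ≤ 1 := by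
    rw [abs_mul, abs_of_nonneg h0]; nlinarith
  calc |1 + lam * (w * χ (n : ZMod q) * (μ n : ℂ)).re|
      ≤ |(1 : ℝ)| + |lam * (w * χ (n : ZMod q) * (μ n : ℂ)).re| := abs_add_le _ _
    _ ≤ 1 + 1 := by rw [abs_one]; exact add_le_add le_rfl h2
    _ = 2 := by norm_num

omit [NeZero q] in
/-- The coefficient as a complex number: `1 + λ Re(wχ(n)μ(n)) = 1 + (λ/2)(w χ(n)μ(n) + w̄ χ̄(n)μ(n))`
(`Re z = (z + z̄)/2`, `conj χ(n) = χ⁻¹(n)`, `μ(n)` real). [folklore] -/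
theorem coeff_eq (w : ℂ) (lam : ℝ) (n : ℕ) :
    (((1 + lam * (w * χ (n : ZMod q) * (μ n : ℂ)).re : ℝ)) : ℂ) =
      1 + (lam / 2 : ℂ) * (w * (χ (n : ZMod q) * (μ n : ℂ)) +
        conj w * (χ⁻¹ (n : ZMod q) * (μ n : ℂ))) := by
  push_cast
  rw [Complex.re_eq_add_conj, map_mul, map_mul, map_intCast]
  have : conj (χ (n : ZMod q)) = χ⁻¹ (n : ZMod q) := MulChar.star_apply' χ (n : ZMod q)
  rw [this]
  ring

/-- `∑ χ(n)μ(n) n^{-s} = 1/L(s, χ)` for `σ > 1` (Mathlib: `L(χ, s) · L(χμ, s) = 1`). [folklore] -/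
theorem LSeries_twist_moebius_eq_inv {s : ℂ} (hs : 1 < s.re) :
    LSeries (fun n : ℕ ↦ χ (n : ZMod q) * (μ n : ℂ)) s = (χ.LFunction s)⁻¹ := by
  have h := DirichletCharacter.LSeries.mul_mu_eq_one χ hs
  rw [← DirichletCharacter.LFunction_eq_LSeries χ hs] at h
  exact eq_inv_of_mul_eq_one_right h

omit [NeZero q] in
/-- Summability of `∑ χ(n)μ(n) n^{-s}` for `σ > 1`. [folklore] -/
theorem LSeriesSummable_twist_moebius {s : ℂ} (hs : 1 < s.re) :
    LSeriesSummable (fun n : ℕ ↦ χ (n : ZMod q) * (μ n : ℂ)) s :=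
  DirichletCharacter.LSeriesSummable_mul χ (ArithmeticFunction.LSeriesSummable_moebius_iff.2 hs)

omit [NeZero q] in
/-- Summability of the Dirichlet series of `1 + λ Re(wχ(n))μ(n)` for `σ > 1` (coefficients
bounded by `2`). [folklore] -/
theorem LSeriesSummable_coeff {w : ℂ} (hw : ‖w‖ ≤ 1) {lam : ℝ} (h0 : 0 ≤ lam) (h1 : lam ≤ 1)
    {s : ℂ} (hs : 1 < s.re) :
    LSeriesSummable (fun n : ℕ ↦ (((1 + lam * (w * χ (n : ZMod q) * (μ n : ℂ)).re : ℝ)) : ℂ)) s := by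
  refine LSeriesSummable_of_bounded_of_one_lt_re (m := 2) (fun n _ ↦ ?_) hs
  rw [Complex.norm_real, Real.norm_eq_abs]
  exact abs_coeff_le χ hw h0 h1 n

/-- **The Dirichlet series of `1 + λ Re(w χ(n)) μ(n)`**: for `σ > 1`,
`∑ (1 + λ Re(wχ(n))μ(n)) n^{-s} = ζ(s) + (λ/2)(w/L(s, χ) + w̄/L(s, χ̄))`.
[cite: MontgomeryVaughan2007, §11.3 Exercise 7] -/
theorem LSeries_coeff_eq {w : ℂ} (hw : ‖w‖ ≤ 1) {lam : ℝ} (h0 : 0 ≤ lam) (h1 : lam ≤ 1)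
    {s : ℂ} (hs : 1 < s.re) :
    LSeries (fun n : ℕ ↦ (((1 + lam * (w * χ (n : ZMod q) * (μ n : ℂ)).re : ℝ)) : ℂ)) s =
      riemannZeta s + (lam / 2 : ℂ) * (w * (χ.LFunction s)⁻¹ + conj w * (χ⁻¹.LFunction s)⁻¹) := by
  have _ := hw; have _ := h0; have _ := h1
  set f₁ : ℕ → ℂ := fun n ↦ χ (n : ZMod q) * (μ n : ℂ) with hf₁
  set f₂ : ℕ → ℂ := fun n ↦ χ⁻¹ (n : ZMod q) * (μ n : ℂ) with hf₂
  have hfun : (fun n : ℕ ↦ (((1 + lam * (w * χ (n : ZMod q) * (μ n : ℂ)).re : ℝ)) : ℂ)) =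
      (1 : ℕ → ℂ) + (lam / 2 : ℂ) • (w • f₁ + conj w • f₂) := by
    funext n
    rw [coeff_eq]
    simp only [Pi.add_apply, Pi.one_apply, Pi.smul_apply, smul_eq_mul, hf₁, hf₂]
  have hs₁ : LSeriesSummable f₁ s := LSeriesSummable_twist_moebius χ hs
  have hs₂ : LSeriesSummable f₂ s := LSeriesSummable_twist_moebius χ⁻¹ hs
  have hsum1 : LSeriesSummable (1 : ℕ → ℂ) s :=
    LSeriesSummable_of_bounded_of_one_lt_re (m := 1) (fun n _ ↦ by simp) hs
  have hsg : LSeriesSummable (w • f₁ + conj w • f₂) s := (hs₁.smul w).add (hs₂.smul _)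
  rw [hfun, LSeries_add hsum1 (hsg.smul _), LSeries_one_eq_riemannZeta hs, LSeries_smul,
    LSeries_add (hs₁.smul w) (hs₂.smul _), LSeries_smul, LSeries_smul,
    LSeries_twist_moebius_eq_inv χ hs, LSeries_twist_moebius_eq_inv χ⁻¹ hs]

end Coeff

/-! ## Real values on the real axis for a quadratic character -/

section RealAxis

variable {q : ℕ} [NeZero q] (χ : DirichletCharacter ℂ q)

/-- For a quadratic character `χ ≠ χ₀` (`χ⁻¹ = χ`): `conj ∘ L(·, χ) ∘ conj = L(·, χ)`
(reflection principle, `DirichletZFR.conj_LFunction_conj`). [folklore] -/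
theorem conj_LFunction_conj_eq (hχ : χ ≠ 1) (hχ2 : χ ^ 2 = 1) :
    (conj ∘ χ.LFunction ∘ conj) = χ.LFunction := by
  have hinv : χ⁻¹ = χ := inv_eq_of_mul_eq_one_left (by rw [← sq, hχ2])
  funext s
  have h := DirichletZFR.conj_LFunction_conj χ hχ s
  rw [hinv] at h
  exact h

/-- `L'(x, χ)` is real for real `x` and quadratic `χ ≠ χ₀`. [folklore] -/
theorem deriv_LFunction_ofReal_im (hχ : χ ≠ 1) (hχ2 : χ ^ 2 = 1) (x : ℝ) :
    (deriv χ.LFunction x).im = 0 := by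
  have h := congr_fun (deriv_conj_conj (f := χ.LFunction)) (x : ℂ)
  rw [conj_LFunction_conj_eq χ hχ hχ2] at h
  simp only [Function.comp_apply, Complex.conj_ofReal] at h
  -- `h : L'(x) = conj (L'(x))`
  have := Complex.conj_eq_iff_im.1 h.symm
  exact this

end RealAxis

/-! ## The hypotheses of Landau's method for `1 + λ Re(w χ(n)) μ(n)` -/

/-- Region bookkeeping: a point of the region `σ > 1 − c/(log q + log(|t|+4))` with
`c ≤ min(c₁, c_ζ)` lies in the regions `σ ≥ 1 − c₁/(log q + log(|t|+4))` and
`σ ≥ 1 − c_ζ/log(|t|+4)`. [folklore] -/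
theorem region_mono {q : ℕ} {c c₁ cζ : ℝ} (hc : 0 < c) (hc₁ : c ≤ c₁) (hcζ : c ≤ cζ) {s : ℂ}
    (hs : 1 - c / (Real.log q + Real.log (|s.im| + 4)) < s.re) :
    1 - c₁ / (Real.log q + Real.log (|s.im| + 4)) ≤ s.re ∧
      1 - cζ / Real.log (|s.im| + 4) ≤ s.re := by
  have hlogq : 0 ≤ Real.log q := Real.log_natCast_nonneg q
  have hlt : 1 ≤ Real.log (|s.im| + 4) := ClassicalZFRData.one_le_log_tau s.im
  have hℒ : 0 < Real.log q + Real.log (|s.im| + 4) := by linarith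
  have h1 : c / (Real.log q + Real.log (|s.im| + 4)) ≤ c₁ / (Real.log q + Real.log (|s.im| + 4)) :=
    div_le_div_of_nonneg_right hc₁ hℒ.le
  have h2 : c / (Real.log q + Real.log (|s.im| + 4)) ≤ cζ / Real.log (|s.im| + 4) :=
    calc c / (Real.log q + Real.log (|s.im| + 4)) ≤ c / Real.log (|s.im| + 4) :=
          div_le_div_of_nonneg_left hc.le (by linarith) (by linarith)
      _ ≤ cζ / Real.log (|s.im| + 4) := div_le_div_of_nonneg_right hcζ (by linarith)
  exact ⟨by linarith, by linarith⟩

/-- `log q + log(|t| + 4) ≤ (log q + log 4) · log(|t| + 4)`. [folklore] -/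
theorem ell_le_ell0_mul (q : ℕ) (t : ℝ) :
    Real.log q + Real.log (|t| + 4) ≤ (Real.log q + Real.log 4) * Real.log (|t| + 4) := by
  have hlogq : 0 ≤ Real.log q := Real.log_natCast_nonneg q
  have hlt : 1 ≤ Real.log (|t| + 4) := ClassicalZFRData.one_le_log_tau t
  have hl4 : 1 ≤ Real.log 4 := by
    have := ClassicalZFRData.one_le_log_tau 0
    rwa [abs_zero, zero_add] at this
  rw [add_mul]
  nlinarith

/-! ## Weakening the constants of `ExcPsiData` -/

/-- `ExcPsiData` is monotone in its constants: the region may be shrunk (`c' ≤ c`) and the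
bound enlarged (`C ≤ C'`). [folklore] -/
theorem _root_.Literature.NumberTheory.LFunctions.ExcPsiData.weaken {Λ : ℕ → ℝ} {F : ℂ → ℂ}
    {c C L β α c' C' : ℝ} (h : ExcPsiData Λ F c C L β α) (hc' : 0 < c') (hc'c : c' ≤ c)
    (hCC' : C ≤ C') : ExcPsiData Λ F c' C' L β α := by
  have hsub : ∀ s : ℂ, 1 - c' / (L + Real.log (|s.im| + 4)) < s.re →
      1 - c / (L + Real.log (|s.im| + 4)) < s.re := by
    intro s hs
    have hℓ := ExcPsiData.ellL_pos h.L_nonneg s.im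
    have : c' / (L + Real.log (|s.im| + 4)) ≤ c / (L + Real.log (|s.im| + 4)) :=
      div_le_div_of_nonneg_right hc'c hℓ.le
    linarith
  refine ⟨hc', hc'c.trans h.c_le, h.C_nonneg.trans hCC', h.L_nonneg, h.β_ge, h.β_lt, h.α_le,
    h.nonneg, h.summable, h.eq, h.differentiableOn.mono (fun s hs ↦ hsub s hs),
    fun s hs hsβ ↦ (h.bound s (hsub s hs) hsβ).trans ?_⟩
  have h1 : 0 ≤ Real.log (|s.im| + 4) ^ 5 := pow_nonneg (ClassicalZFRData.log_tau_pos s.im).le 5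
  have h2 : 0 ≤ 1 + ‖s - (β : ℂ)‖⁻¹ := by positivity
  exact mul_le_mul_of_nonneg_right (mul_le_mul_of_nonneg_right hCC' h1) h2

/-! ## The principal character: `1/L(s, χ₀) = ∏_{p ∣ q}(1 − p^{-s})^{-1} · 1/ζ(s)` -/

/-- `ζ` near `σ = 1`: `ζ₀(s) = ζ(s) − 1/(s − 1) ≪ log(|t|+4)`, `ζ₁(s) = (s − 1)ζ(s) ≠ 0` and
`(s − 1)/ζ₁(s) = 1/ζ(s) ≪ log(|t|+4)` on `σ ≥ 1 − c/log(|t| + 4)` (`c ≤ 1/4`), including the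
point `s = 1` where `(s − 1)/ζ₁(s) = 0`; from `ZetaClassicalRegion.exists_zeroFreeRegion_bounds`.
[cite: Titchmarsh1986, Theorem 3.11 eq. (3.11.7) and (3.11.8)] -/
theorem exists_zeta_region_bounds :
    ∃ c : ℝ, 0 < c ∧ c ≤ 1 / 4 ∧ ∃ C : ℝ, 0 ≤ C ∧ ∀ s : ℂ, 1 - c / Real.log (|s.im| + 4) ≤ s.re →
      ‖riemannZeta₀ s‖ ≤ C * Real.log (|s.im| + 4) ∧ riemannZeta₁ s ≠ 0 ∧
      ‖(s - 1) / riemannZeta₁ s‖ ≤ C * Real.log (|s.im| + 4) := by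
  obtain ⟨cbar, hcb0, hcb1, C, hC0, hreg⟩ := ZetaClassicalRegion.exists_zeroFreeRegion_bounds
  refine ⟨4 * cbar, by positivity, by linarith, 2 * C + ‖riemannZeta₀ 1‖, by positivity,
    fun s hs ↦ ?_⟩
  have hl3 : 1 < Real.log (|s.im| + 3) := ZetaClassicalRegion.one_lt_log_abs_add_three s.im
  have h34 : Real.log (|s.im| + 3) ≤ Real.log (|s.im| + 4) :=
    Real.log_le_log (by positivity) (by linarith)
  have hl4 : 1 ≤ Real.log (|s.im| + 4) := by linarith
  have hγ := norm_nonneg (riemannZeta₀ 1)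
  have hCl : 0 ≤ (2 * C + ‖riemannZeta₀ 1‖) * Real.log (|s.im| + 4) := by positivity
  by_cases h1 : s = 1
  · subst h1
    refine ⟨?_, by rw [riemannZeta₁_one]; exact one_ne_zero, by rw [sub_self, zero_div, norm_zero]; exact hCl⟩
    calc ‖riemannZeta₀ 1‖ = ‖riemannZeta₀ 1‖ * 1 := (mul_one _).symm
      _ ≤ (2 * C + ‖riemannZeta₀ 1‖) * Real.log (|(1 : ℂ).im| + 4) :=
          mul_le_mul (by linarith) hl4 zero_le_one (by positivity)
  · have hreg' : 1 - 4 * cbar / Real.log (|s.im| + 3) ≤ s.re := by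
      have : 4 * cbar / Real.log (|s.im| + 4) ≤ 4 * cbar / Real.log (|s.im| + 3) :=
        div_le_div_of_nonneg_left (by positivity) (by linarith) h34
      linarith
    obtain ⟨hζ0, hsub, hinv, -⟩ := hreg s h1 hreg'
    have hs1 : s - 1 ≠ 0 := sub_ne_zero.2 h1
    have hζ₁ : riemannZeta₁ s = (s - 1) * riemannZeta s := by
      rw [riemannZeta_eq_inv_sub_mul h1, ← mul_assoc, mul_inv_cancel₀ hs1, one_mul]
    have hζ₀ : riemannZeta₀ s = riemannZeta s - 1 / (s - 1) := by
      rw [riemannZeta_eq_inv_sub_add h1, one_div]; ring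
    refine ⟨?_, ?_, ?_⟩
    · rw [hζ₀]
      calc ‖riemannZeta s - 1 / (s - 1)‖ ≤ C * Real.log (|s.im| + 3) := hsub
        _ ≤ (2 * C + ‖riemannZeta₀ 1‖) * Real.log (|s.im| + 4) := by nlinarith
    · rw [hζ₁]; exact mul_ne_zero hs1 hζ0
    · rw [hζ₁, div_mul_eq_div_div, div_self hs1, one_div]
      calc ‖(riemannZeta s)⁻¹‖ ≤ C * Real.log (|s.im| + 3) := hinv
        _ ≤ (2 * C + ‖riemannZeta₀ 1‖) * Real.log (|s.im| + 4) := by nlinarith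

/-- The inverse Euler factor at `q`: for `σ ≥ 3/4`, `‖∏_{p ∣ q}(1 − p^{-s})^{-1}‖ ≤ 4^{ω(q)} ≤ q²`
(`|p^{-s}| ≤ 3/4`; `2^{ω(q)} ≤ q` as in the tree's `GPY.two_pow_card_primeFactors_le`). [folklore] -/
theorem norm_inv_eulerFactor_le (q : ℕ) [NeZero q] {s : ℂ} (hs : 3 / 4 ≤ s.re) :
    ‖(∏ p ∈ q.primeFactors, (1 - (p : ℂ) ^ (-s)))⁻¹‖ ≤ (q : ℝ) ^ 2 := by
  have hq : q ≠ 0 := NeZero.ne q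
  rw [norm_inv, norm_prod]
  have hfac : ∀ p ∈ q.primeFactors, 1 / 4 ≤ ‖1 - (p : ℂ) ^ (-s)‖ := by
    intro p hp
    have hn := SiegelWalfisz.norm_prime_cpow_neg_le (Nat.prime_of_mem_primeFactors hp) hs
    have := norm_sub_norm_le (1 : ℂ) ((p : ℂ) ^ (-s))
    rw [norm_one] at this
    linarith
  have hlow : (1 / 4 : ℝ) ^ q.primeFactors.card ≤ ∏ p ∈ q.primeFactors, ‖1 - (p : ℂ) ^ (-s)‖ := by
    rw [← Finset.prod_const]
    exact Finset.prod_le_prod (fun _ _ ↦ by norm_num) hfac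
  have hpos : 0 < (1 / 4 : ℝ) ^ q.primeFactors.card := by positivity
  calc (∏ p ∈ q.primeFactors, ‖1 - (p : ℂ) ^ (-s)‖)⁻¹ ≤ ((1 / 4 : ℝ) ^ q.primeFactors.card)⁻¹ :=
        inv_anti₀ hpos hlow
    _ = (4 : ℝ) ^ q.primeFactors.card := by rw [one_div, inv_pow, inv_inv]
    _ = ((2 : ℝ) ^ q.primeFactors.card) ^ 2 := by
        rw [show (4 : ℝ) = 2 ^ 2 by norm_num, ← pow_mul, ← pow_mul, mul_comm]
    _ ≤ (q : ℝ) ^ 2 := by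
        have h2 : 2 ^ q.primeFactors.card ≤ q :=
          calc 2 ^ q.primeFactors.card ≤ ∏ p ∈ q.primeFactors, p :=
                Finset.pow_card_le_prod _ _ _ fun p hp ↦ (Nat.prime_of_mem_primeFactors hp).two_le
            _ ≤ q := Nat.le_of_dvd (Nat.pos_of_ne_zero hq) (Nat.prod_primeFactors_dvd q)
        gcongr
        exact_mod_cast h2

set_option maxHeartbeats 800000 in
/-- **Landau's method applies to `1 + λ Re(w) 𝟙_{(n,q)=1} μ(n)` (the principal character).**
For `q ≥ 1`, `|w| ≤ 1`, `0 < λ ≤ 1`, the sequence `Λ'(n) = 1 + λ Re(w χ₀(n)) μ(n)` satisfies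
`ExcPsiData Λ' F c (C₀ q²) (log q) (1/2) 0` with ABSOLUTE `c, C₀`: its Dirichlet series is
`ζ(s) + λ Re(w)/L(s, χ₀) = 1/(s−1) + ζ₀(s) + λ Re(w) ∏_{p ∣ q}(1 − p^{-s})^{-1} (s−1)/ζ₁(s)`
(Mathlib: `L(s, χ₀) = ζ(s)∏_{p ∣ q}(1 − p^{-s})`, `ζ(s) = ζ₁(s)/(s−1)`), holomorphic on the
classical region of `ζ` with `|F(s)| ≤ (C + C q²) log(|t| + 4)` there (`1/ζ ≪ log(|t|+4)`,
`|∏(1 − p^{-s})^{-1}| ≤ q²`). [cite: MontgomeryVaughan2007, §11.3 Exercise 7] -/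
theorem exists_excPsiData_principal :
    ∃ c : ℝ, 0 < c ∧ c ≤ 1 / 2 ∧ ∃ C₀ : ℝ, 0 ≤ C₀ ∧
      ∀ (q : ℕ) [NeZero q] (w : ℂ), ‖w‖ ≤ 1 → ∀ lam : ℝ, 0 < lam → lam ≤ 1 →
        ∃ F : ℂ → ℂ,
          ExcPsiData
            (fun n : ℕ ↦ 1 + lam * (w * (1 : DirichletCharacter ℂ q) (n : ZMod q) * (μ n : ℂ)).re)
            F c (C₀ * (q : ℝ) ^ 2) (Real.log q) (1 / 2) 0 := by
  obtain ⟨cz, hcz, hcz4, C, hC0, hζ⟩ := exists_zeta_region_bounds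
  refine ⟨min cz (1 / 2), lt_min hcz (by norm_num), min_le_right _ _, 2 * C + 2, by positivity,
    fun q _ w hw lam hlam0 hlam1 ↦ ?_⟩
  set c : ℝ := min cz (1 / 2) with hcdef
  have hccz : c ≤ cz := min_le_left _ _
  have hcpos : 0 < c := lt_min hcz (by norm_num)
  have hlogq : 0 ≤ Real.log q := Real.log_natCast_nonneg q
  have hq1 : (1 : ℝ) ≤ q := by exact_mod_cast NeZero.one_le
  have hwre : |w.re| ≤ 1 := (Complex.abs_re_le_norm w).trans hw
  set E : ℂ → ℂ := fun s ↦ ∏ p ∈ q.primeFactors, (1 - (p : ℂ) ^ (-s)) with hEdef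
  have hEd : Differentiable ℂ E := SiegelWalfisz.differentiable_eulerFactor q
  set F : ℂ → ℂ := fun s ↦ riemannZeta₀ s +
    ((lam * w.re : ℝ) : ℂ) * ((E s)⁻¹ * ((s - 1) / riemannZeta₁ s)) with hFdef
  -- points of the region
  have hreg : ∀ s : ℂ, 1 - c / (Real.log q + Real.log (|s.im| + 4)) < s.re →
      3 / 4 ≤ s.re ∧ 1 - cz / Real.log (|s.im| + 4) ≤ s.re ∧ 1 ≤ Real.log (|s.im| + 4) := by
    intro s hs
    obtain ⟨-, h2⟩ := region_mono (c₁ := c) hcpos le_rfl hccz hs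
    have hlt : 1 ≤ Real.log (|s.im| + 4) := ClassicalZFRData.one_le_log_tau s.im
    have : cz / Real.log (|s.im| + 4) ≤ cz := div_le_self hcz.le hlt
    exact ⟨by linarith, h2, hlt⟩
  refine ⟨F, hcpos, min_le_right _ _, by positivity, hlogq, le_rfl, by norm_num, by simp,
    coeff_nonneg 1 hw hlam0.le hlam1, fun s hs ↦ LSeriesSummable_coeff 1 hw hlam0.le hlam1 hs,
    fun s hs ↦ ?_, fun s hs ↦ ?_, fun s hs _ ↦ ?_⟩
  · -- the Dirichlet series
    have hs1 : s ≠ 1 := by rintro rfl; simp at hs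
    have hs1' : s - 1 ≠ 0 := sub_ne_zero.2 hs1
    have hζne : riemannZeta s ≠ 0 := riemannZeta_ne_zero_of_one_lt_re hs
    have hE0 : E s ≠ 0 := (SiegelWalfisz.eulerFactor_ne_zero_and_norm_logDeriv_le q (by linarith)).1
    have hL1 : (1 : DirichletCharacter ℂ q).LFunction s = E s * riemannZeta s :=
      DirichletCharacter.LFunctionTrivChar_eq_mul_riemannZeta hs1
    have hζ₁ : riemannZeta₁ s = (s - 1) * riemannZeta s := by
      rw [riemannZeta_eq_inv_sub_mul hs1, ← mul_assoc, mul_inv_cancel₀ hs1', one_mul]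
    have hinvL : (E s * riemannZeta s)⁻¹ = (E s)⁻¹ * ((s - 1) / riemannZeta₁ s) := by
      rw [mul_inv, hζ₁, div_mul_eq_div_div, div_self hs1', one_div]
    rw [LSeries_coeff_eq 1 hw hlam0.le hlam1 hs, inv_one, hL1, hinvL, hFdef]
    simp only
    rw [riemannZeta_eq_inv_sub_add hs1]
    have hwre' : w + conj w = ((2 * w.re : ℝ) : ℂ) := by rw [Complex.add_conj]
    have e1 : (lam / 2 : ℂ) * (w * ((E s)⁻¹ * ((s - 1) / riemannZeta₁ s)) +
        conj w * ((E s)⁻¹ * ((s - 1) / riemannZeta₁ s))) =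
        ((lam * w.re : ℝ) : ℂ) * ((E s)⁻¹ * ((s - 1) / riemannZeta₁ s)) := by
      rw [← add_mul, hwre']; push_cast; ring
    rw [e1]
    push_cast
    ring
  · -- holomorphy
    obtain ⟨h34, hsz, -⟩ := hreg s hs
    obtain ⟨-, hζ₁0, -⟩ := hζ s hsz
    have hE0 : E s ≠ 0 := (SiegelWalfisz.eulerFactor_ne_zero_and_norm_logDeriv_le q h34).1
    have h1 : DifferentiableAt ℂ (fun z ↦ (E z)⁻¹) s := (hEd s).inv hE0
    have h2 : DifferentiableAt ℂ (fun z : ℂ ↦ (z - 1) / riemannZeta₁ z) s :=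
      ((differentiableAt_id.sub_const 1).div (differentiable_riemannZeta₁ s) hζ₁0)
    exact ((differentiable_riemannZeta₀ s).add ((h1.mul h2).const_mul _)).differentiableWithinAt
  · -- the bound
    obtain ⟨h34, hsz, hlt⟩ := hreg s hs
    obtain ⟨hζ₀b, -, hinvb⟩ := hζ s hsz
    set lt : ℝ := Real.log (|s.im| + 4) with hltdef
    set d : ℝ := ‖s - ((1 / 2 : ℝ) : ℂ)‖⁻¹ with hddef
    have hd0 : 0 ≤ d := inv_nonneg.2 (norm_nonneg _)
    have hEb : ‖(E s)⁻¹‖ ≤ (q : ℝ) ^ 2 := norm_inv_eulerFactor_le q h34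
    have hcoef : ‖((lam * w.re : ℝ) : ℂ)‖ ≤ 1 := by
      rw [Complex.norm_real, Real.norm_eq_abs, abs_mul, abs_of_pos hlam0]; nlinarith
    have hmain : ‖((lam * w.re : ℝ) : ℂ) * ((E s)⁻¹ * ((s - 1) / riemannZeta₁ s))‖ ≤
        (q : ℝ) ^ 2 * (C * lt) := by
      rw [norm_mul, norm_mul]
      calc ‖((lam * w.re : ℝ) : ℂ)‖ * (‖(E s)⁻¹‖ * ‖(s - 1) / riemannZeta₁ s‖)
          ≤ 1 * ((q : ℝ) ^ 2 * (C * lt)) :=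
            mul_le_mul hcoef (mul_le_mul hEb hinvb (norm_nonneg _) (by positivity))
              (by positivity) zero_le_one
        _ = _ := one_mul _
    have hlt5 : lt ≤ lt ^ 5 := by
      calc lt = lt ^ 1 := (pow_one lt).symm
        _ ≤ lt ^ 5 := pow_le_pow_right₀ hlt (by norm_num)
    have hq2 : (1 : ℝ) ≤ (q : ℝ) ^ 2 := one_le_pow₀ hq1
    calc ‖F s‖ ≤ ‖riemannZeta₀ s‖ + ‖((lam * w.re : ℝ) : ℂ) * ((E s)⁻¹ * ((s - 1) / riemannZeta₁ s))‖ :=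
          norm_add_le _ _
      _ ≤ C * lt + (q : ℝ) ^ 2 * (C * lt) := add_le_add hζ₀b hmain
      _ ≤ (2 * C + 2) * (q : ℝ) ^ 2 * lt * (1 + d) := by
          have h1 : C * lt ≤ (q : ℝ) ^ 2 * (C * lt) := by
            have : 0 ≤ C * lt := by positivity
            nlinarith
          have h2 : 0 ≤ (2 * C + 2) * (q : ℝ) ^ 2 * lt * d := by positivity
          have h3 : 0 ≤ (q : ℝ) ^ 2 * lt := by positivity
          nlinarith
      _ ≤ (2 * C + 2) * (q : ℝ) ^ 2 * lt ^ 5 * (1 + d) := by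
          refine mul_le_mul_of_nonneg_right (mul_le_mul_of_nonneg_left hlt5 (by positivity)) ?_
          positivity

set_option maxHeartbeats 1600000 in
/-- **Landau's method with an exceptional zero applies to `1 + λ Re(w χ(n)) μ(n)`**
(Montgomery–Vaughan §11.3, Exercises 7–8, in the Riesz-mean normalisation of the tree's
`ExcPsiData`, MV Theorem 11.16): there are ABSOLUTE constants `0 < c ≤ 1/2`, `K ≥ 0`, `C₀ ≥ 0`
such that for every `q ≥ 1`, every non-principal `χ` mod `q` and every `|w| ≤ 1`, with the
normalisation `λ = 1/(K(log q + log 4) + 1)`, the non-negative sequence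
`Λ'(n) = 1 + λ Re(w χ(n)) μ(n)` satisfies `ExcPsiData Λ' F c C₀ (log q) β α` for suitable
`F`, `β`, `α`, where EITHER `α = 0` (no exceptional zero: `∑ Λ'(n)n^{-s} = ζ(s) +
(λ/2)(w/L(s,χ) + w̄/L(s,χ̄))` has its only pole at `s = 1`), OR `χ` is quadratic and `β` is a
real zero of `L(s, χ)` (the exceptional zero; then `1/L(s, χ)` has the simple pole at `β` with
residue `1/L'(β, χ)`, and `α = −λ Re(w)/L'(β, χ)`, `|α| ≤ 1` by the choice of `λ` and
`1/L'(β, χ) ≪ log 4q`). The bound `|F(s)| ≤ C₀ log⁵(|t|+4)(1 + 1/|s − β|)` on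
`σ > 1 − c/(log q + log(|t| + 4))` is MV Theorem 11.4 (11.7)/(11.10)
(`DirichletZFR.exists_inv_LFunction_bounds`) together with `ζ(s) − 1/(s−1) ≪ log(|t|+4)`.
[cite: MontgomeryVaughan2007, §11.3 Exercise 7] -/
theorem exists_excPsiData_twist :
    ∃ c : ℝ, 0 < c ∧ c ≤ 1 / 2 ∧ ∃ K : ℝ, 0 ≤ K ∧ ∃ C₀ : ℝ, 0 ≤ C₀ ∧
      ∀ (q : ℕ) [NeZero q] (χ : DirichletCharacter ℂ q), χ ≠ 1 → ∀ w : ℂ, ‖w‖ ≤ 1 →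
        ∃ (β α : ℝ) (F : ℂ → ℂ), (α = 0 ∨ (χ ^ 2 = 1 ∧ χ.LFunction β = 0)) ∧
          ExcPsiData
            (fun n : ℕ ↦ 1 + 1 / (K * (Real.log q + Real.log 4) + 1) *
              (w * χ (n : ZMod q) * (μ n : ℂ)).re)
            F c C₀ (Real.log q) β α := by
  obtain ⟨c₁, hc₁, hc₁4, C₁, hC₁, hzf, -, hA, hB⟩ := DirichletZFR.exists_inv_LFunction_bounds
  obtain ⟨cζ, hcζ, Cζ, hCζ, hζ⟩ := exists_norm_riemannZeta₀_le
  set c : ℝ := min c₁ (min cζ (1 / 2)) with hcdef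
  have hcc₁ : c ≤ c₁ := min_le_left _ _
  have hccζ : c ≤ cζ := (min_le_right _ _).trans (min_le_left _ _)
  have hc2 : c ≤ 1 / 2 := (min_le_right _ _).trans (min_le_right _ _)
  have hcpos : 0 < c := lt_min hc₁ (lt_min hcζ (by norm_num))
  clear_value c
  refine ⟨c, hcpos, hc2, C₁, hC₁, Cζ + 2, by positivity, fun q _ χ hχ w hw ↦ ?_⟩
  -- quantities at the modulus `q`
  have hlogq : 0 ≤ Real.log q := Real.log_natCast_nonneg q
  set ℒ₀ : ℝ := Real.log q + Real.log 4 with hℒ₀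
  have hℒ₀1 : 1 ≤ ℒ₀ := PagePNT.one_le_ell0 q
  have hℒ₀0 : 0 < ℒ₀ := by linarith
  set lam : ℝ := 1 / (C₁ * ℒ₀ + 1) with hlam
  have hlam0 : 0 < lam := by rw [hlam]; positivity
  have hlam1 : lam ≤ 1 := by
    rw [hlam, div_le_one (by positivity)]; nlinarith
  have hlamC : lam * (C₁ * ℒ₀) ≤ 1 := by
    rw [hlam, div_mul_eq_mul_div, one_mul, div_le_one (by positivity)]; linarith
  have hwre : |w.re| ≤ 1 := (Complex.abs_re_le_norm w).trans hw
  have hχinv1 : χ⁻¹ ≠ 1 := inv_ne_one.mpr hχ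
  have hLd := DirichletCharacter.differentiable_LFunction hχ
  have hLd' := DirichletCharacter.differentiable_LFunction hχinv1
  -- common analytic facts at a point of the region
  have hreg : ∀ s : ℂ, 1 - c / (Real.log q + Real.log (|s.im| + 4)) < s.re →
      1 - c₁ / (Real.log q + Real.log (|s.im| + 4)) ≤ s.re ∧
      ‖riemannZeta₀ s‖ ≤ Cζ * Real.log (|s.im| + 4) ∧
      1 ≤ Real.log (|s.im| + 4) ∧
      lam * (C₁ * (Real.log q + Real.log (|s.im| + 4))) ≤ Real.log (|s.im| + 4) := by
    intro s hs
    obtain ⟨h1, h2⟩ := region_mono hcpos hcc₁ hccζ hs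
    have hlt : 1 ≤ Real.log (|s.im| + 4) := ClassicalZFRData.one_le_log_tau s.im
    refine ⟨h1, hζ s h2, hlt, ?_⟩
    calc lam * (C₁ * (Real.log q + Real.log (|s.im| + 4)))
        ≤ lam * (C₁ * (ℒ₀ * Real.log (|s.im| + 4))) := by
          refine mul_le_mul_of_nonneg_left (mul_le_mul_of_nonneg_left ?_ hC₁) hlam0.le
          exact ell_le_ell0_mul q s.im
      _ = lam * (C₁ * ℒ₀) * Real.log (|s.im| + 4) := by ring
      _ ≤ 1 * Real.log (|s.im| + 4) := mul_le_mul_of_nonneg_right hlamC (by linarith)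
      _ = Real.log (|s.im| + 4) := one_mul _
  -- the coefficients
  have hnonneg : ∀ n : ℕ, 0 ≤ 1 + lam * (w * χ (n : ZMod q) * (μ n : ℂ)).re :=
    coeff_nonneg χ hw hlam0.le hlam1
  have hsum : ∀ s : ℂ, 1 < s.re →
      LSeriesSummable (fun n : ℕ ↦ (((1 + lam * (w * χ (n : ZMod q) * (μ n : ℂ)).re : ℝ)) : ℂ)) s :=
    fun s hs ↦ LSeriesSummable_coeff χ hw hlam0.le hlam1 hs
  have hpow5 : ∀ x : ℝ, 1 ≤ x → x ≤ x ^ 5 := fun x hx ↦ by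
    calc x = x ^ 1 := (pow_one x).symm
      _ ≤ x ^ 5 := pow_le_pow_right₀ hx (by norm_num)
  by_cases hex : χ ^ 2 = 1 ∧ ∃ β : ℝ, χ.LFunction β = 0 ∧ 1 - 2 * c₁ / ℒ₀ < β
  · /- Case 1: the exceptional zero `β` of the quadratic character `χ`. -/
    obtain ⟨hχ2, β, hβ, hβc⟩ := hex
    have hinv : χ⁻¹ = χ := inv_eq_of_mul_eq_one_left (by rw [← sq, hχ2])
    obtain ⟨hderiv, hinvd, hBs⟩ := hB q χ hχ β hβ hβc
    have hβ1 : β < 1 := by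
      by_contra hcon
      exact DirichletCharacter.LFunction_ne_zero_of_one_le_re χ (Or.inl hχ)
        (s := β) (by simpa using not_lt.1 hcon) hβ
    have hβhalf : 1 / 2 ≤ β := by
      have : 2 * c₁ / ℒ₀ ≤ 2 * c₁ := div_le_self (by positivity) hℒ₀1
      linarith
    -- `g = L/(s − β)`, `h = 1/g`, `α₀ = h(β) = 1/L'(β)` (real)
    set g : ℂ → ℂ := dslope χ.LFunction (β : ℂ) with hgdef
    have hgd : Differentiable ℂ g := PagePNT.differentiable_dslope_LFunction χ hχ _
    have hgβ : g β = deriv χ.LFunction β := by rw [hgdef, dslope_same]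
    have hgβ0 : g β ≠ 0 := by rw [hgβ]; exact hderiv
    set h : ℂ → ℂ := fun z ↦ (g z)⁻¹ with hhdef
    set α₀ : ℝ := ((deriv χ.LFunction β)⁻¹).re with hα₀
    have hα₀eq : ((α₀ : ℝ) : ℂ) = (deriv χ.LFunction β)⁻¹ := by
      apply Complex.ext
      · simp [hα₀]
      · rw [Complex.ofReal_im, Complex.inv_im, deriv_LFunction_ofReal_im χ hχ hχ2 β]
        simp
    have hhβ : h β = (α₀ : ℂ) := by rw [hα₀eq, hhdef]; simp only; rw [hgβ]
    have hα₀abs : |α₀| ≤ C₁ * ℒ₀ := by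
      have : |α₀| = ‖((α₀ : ℝ) : ℂ)‖ := by rw [Complex.norm_real, Real.norm_eq_abs]
      rw [this, hα₀eq]; exact hinvd
    set α : ℝ := -(lam * w.re * α₀) with hαdef
    have hαle : |α| ≤ 1 := by
      rw [hαdef, abs_neg, abs_mul, abs_mul, abs_of_pos hlam0]
      calc lam * |w.re| * |α₀| ≤ lam * 1 * (C₁ * ℒ₀) := by gcongr
        _ = lam * (C₁ * ℒ₀) := by ring
        _ ≤ 1 := hlamC
    set F : ℂ → ℂ := fun s ↦ riemannZeta₀ s + ((lam * w.re : ℝ) : ℂ) * dslope h (β : ℂ) s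
      with hFdef
    -- `L(s) ≠ 0` off `β` in the region, and the two formulas for `1/L`
    have hoff : ∀ s : ℂ, 1 - c₁ / (Real.log q + Real.log (|s.im| + 4)) ≤ s.re → s ≠ β →
        χ.LFunction s ≠ 0 ∧ g s ≠ 0 ∧
        dslope h (β : ℂ) s = (χ.LFunction s)⁻¹ - (α₀ : ℂ) * (s - β)⁻¹ ∧
        ‖(χ.LFunction s)⁻¹‖ ≤ C₁ * (Real.log q + Real.log (|s.im| + 4)) * (1 + ‖s - β‖⁻¹) := by
      intro s hs hsβ
      obtain ⟨hL0, hLb⟩ := hBs s hs hsβ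
      have hg0 : g s ≠ 0 := PagePNT.dslope_ne_zero_of_ne χ hβ hL0
      have hLg : χ.LFunction s = (s - β) * g s := by
        rw [hgdef]; exact PagePNT.LFunction_eq_mul_dslope χ hβ s
      have hsβ' : s - β ≠ 0 := sub_ne_zero.2 hsβ
      refine ⟨hL0, hg0, ?_, hLb⟩
      rw [dslope_of_ne _ hsβ, slope_def_field, hhβ, hLg, mul_inv]
      simp only [hhdef]
      field_simp
    -- differentiability of `dslope h β` at points of the region
    have hdiffh : ∀ s : ℂ, 1 - c₁ / (Real.log q + Real.log (|s.im| + 4)) ≤ s.re →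
        DifferentiableAt ℂ (dslope h (β : ℂ)) s := by
      intro s hs
      rcases eq_or_ne s (β : ℂ) with rfl | hsβ
      · -- `h` is analytic at `β`
        have han : AnalyticAt ℂ h β := (hgd.analyticAt _).inv hgβ0
        obtain ⟨p, hp⟩ := han
        exact (hp.has_fpower_series_dslope_fslope.analyticAt).differentiableAt
      · obtain ⟨-, hg0, -⟩ := hoff s hs hsβ
        exact (differentiableAt_dslope_of_ne hsβ).2 (((hgd s).inv hg0))
    refine ⟨β, α, F, Or.inr ⟨hχ2, hβ⟩, hcpos, hc2, by positivity, hlogq, hβhalf, hβ1, hαle,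
      hnonneg, hsum, fun s hs ↦ ?_, fun s hs ↦ ?_, fun s hs hsβ ↦ ?_⟩
    · -- the Dirichlet series: `ζ + λ Re(w)/L = 1/(s−1) − α/(s−β) + F`
      have hs1 : s ≠ 1 := by rintro rfl; simp at hs
      have hsβ : s ≠ (β : ℂ) := by
        intro h; rw [h, Complex.ofReal_re] at hs; linarith
      have hsreg : 1 - c₁ / (Real.log q + Real.log (|s.im| + 4)) ≤ s.re := by
        have : 0 < c₁ / (Real.log q + Real.log (|s.im| + 4)) :=
          div_pos hc₁ (DirichletZFR.ell_pos q s.im)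
        linarith
      obtain ⟨hL0, -, hds, -⟩ := hoff s hsreg hsβ
      rw [LSeries_coeff_eq χ hw hlam0.le hlam1 hs, hinv, riemannZeta_eq_inv_sub_add hs1, hFdef]
      simp only
      rw [hds]
      have hwre' : w + conj w = ((2 * w.re : ℝ) : ℂ) := by
        rw [Complex.add_conj]
      have e1 : (lam / 2 : ℂ) * (w * (χ.LFunction s)⁻¹ + conj w * (χ.LFunction s)⁻¹) =
          ((lam * w.re : ℝ) : ℂ) * (χ.LFunction s)⁻¹ := by
        rw [← add_mul, hwre']; push_cast; ring
      rw [e1, hαdef]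
      push_cast
      ring
    · -- holomorphy
      obtain ⟨hsreg, -, -, -⟩ := hreg s hs
      exact ((differentiable_riemannZeta₀ s).add ((hdiffh s hsreg).const_mul _)).differentiableWithinAt
    · -- the bound, off `β`
      obtain ⟨hsreg, hζb, hlt, hlamℒ⟩ := hreg s hs
      obtain ⟨hL0, -, hds, hLb⟩ := hoff s hsreg hsβ
      set lt : ℝ := Real.log (|s.im| + 4) with hltdef
      set d : ℝ := ‖s - (β : ℂ)‖⁻¹ with hddef
      have hd0 : 0 ≤ d := inv_nonneg.2 (norm_nonneg _)
      have hcoef : ‖((lam * w.re : ℝ) : ℂ)‖ ≤ lam := by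
        rw [Complex.norm_real, Real.norm_eq_abs, abs_mul, abs_of_pos hlam0]
        nlinarith
      have hpol : ‖(α₀ : ℂ) * (s - β)⁻¹‖ ≤ C₁ * ℒ₀ * d := by
        rw [norm_mul, norm_inv, Complex.norm_real, Real.norm_eq_abs]
        exact mul_le_mul_of_nonneg_right hα₀abs hd0
      have hdsb : ‖dslope h (β : ℂ) s‖ ≤
          C₁ * (Real.log q + lt) * (1 + d) + C₁ * ℒ₀ * d := by
        rw [hds]
        exact (norm_sub_le _ _).trans (add_le_add hLb hpol)
      have hlamℒ₀ : lam * (C₁ * ℒ₀) ≤ lt := hlamC.trans hlt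
      have hmain : ‖((lam * w.re : ℝ) : ℂ) * dslope h (β : ℂ) s‖ ≤ lt * (1 + d) + lt * d := by
        rw [norm_mul]
        calc ‖((lam * w.re : ℝ) : ℂ)‖ * ‖dslope h (β : ℂ) s‖
            ≤ lam * (C₁ * (Real.log q + lt) * (1 + d) + C₁ * ℒ₀ * d) :=
              mul_le_mul hcoef hdsb (norm_nonneg _) hlam0.le
          _ = lam * (C₁ * (Real.log q + lt)) * (1 + d) + lam * (C₁ * ℒ₀) * d := by ring
          _ ≤ lt * (1 + d) + lt * d := by
              refine add_le_add (mul_le_mul_of_nonneg_right hlamℒ (by positivity))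
                (mul_le_mul_of_nonneg_right hlamℒ₀ hd0)
      have hlt5 := hpow5 lt hlt
      calc ‖F s‖ ≤ ‖riemannZeta₀ s‖ + ‖((lam * w.re : ℝ) : ℂ) * dslope h (β : ℂ) s‖ :=
            norm_add_le _ _
        _ ≤ Cζ * lt + (lt * (1 + d) + lt * d) := add_le_add hζb hmain
        _ ≤ (Cζ + 2) * lt * (1 + d) := by
            have : 0 ≤ Cζ * lt * d := by positivity
            nlinarith
        _ ≤ (Cζ + 2) * lt ^ 5 * (1 + d) := by
            refine mul_le_mul_of_nonneg_right (mul_le_mul_of_nonneg_left hlt5 (by positivity)) ?_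
            positivity
  · /- Case 2: no exceptional zero for `χ`, nor for `χ̄`. -/
    have hnone : ∀ β : ℝ, χ.LFunction β = 0 → β ≤ 1 - 2 * c₁ / ℒ₀ := by
      intro β hβ
      by_contra hcon
      have hβc : 1 - 2 * c₁ / ℒ₀ < β := not_le.1 hcon
      have hχ2 : χ ^ 2 = 1 := by
        refine (hzf q χ hχ β hβ ?_).1
        simpa only [Complex.ofReal_im, abs_zero, zero_add, Complex.ofReal_re] using hβc
      exact hex ⟨hχ2, β, hβ, hβc⟩
    have hnone' : ∀ β : ℝ, χ⁻¹.LFunction β = 0 → β ≤ 1 - 2 * c₁ / ℒ₀ := by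
      intro β hβ
      by_contra hcon
      have hβc : 1 - 2 * c₁ / ℒ₀ < β := not_le.1 hcon
      have hχ2' : χ⁻¹ ^ 2 = 1 := by
        refine (hzf q χ⁻¹ hχinv1 β hβ ?_).1
        simpa only [Complex.ofReal_im, abs_zero, zero_add, Complex.ofReal_re] using hβc
      have hχ2 : χ ^ 2 = 1 := by
        have := congrArg (fun x ↦ x⁻¹) hχ2'
        simpa using this
      have hinv : χ⁻¹ = χ := inv_eq_of_mul_eq_one_left (by rw [← sq, hχ2])
      rw [hinv] at hβ
      exact hex ⟨hχ2, β, hβ, hβc⟩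
    set F : ℂ → ℂ := fun s ↦ riemannZeta₀ s +
      (lam / 2 : ℂ) * (w * (χ.LFunction s)⁻¹ + conj w * (χ⁻¹.LFunction s)⁻¹) with hFdef
    have hoff : ∀ s : ℂ, 1 - c₁ / (Real.log q + Real.log (|s.im| + 4)) ≤ s.re →
        χ.LFunction s ≠ 0 ∧ χ⁻¹.LFunction s ≠ 0 ∧
        ‖(χ.LFunction s)⁻¹‖ ≤ C₁ * (Real.log q + Real.log (|s.im| + 4)) ∧
        ‖(χ⁻¹.LFunction s)⁻¹‖ ≤ C₁ * (Real.log q + Real.log (|s.im| + 4)) := by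
      intro s hs
      obtain ⟨h1, h2⟩ := hA q χ hχ hnone s hs
      obtain ⟨h3, h4⟩ := hA q χ⁻¹ hχinv1 hnone' s hs
      exact ⟨h1, h3, h2, h4⟩
    refine ⟨1 / 2, 0, F, Or.inl rfl, hcpos, hc2, by positivity, hlogq, le_rfl, by norm_num,
      by simp, hnonneg, hsum, fun s hs ↦ ?_, fun s hs ↦ ?_, fun s hs _ ↦ ?_⟩
    · -- the Dirichlet series
      have hs1 : s ≠ 1 := by rintro rfl; simp at hs
      rw [LSeries_coeff_eq χ hw hlam0.le hlam1 hs, riemannZeta_eq_inv_sub_add hs1, hFdef]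
      push_cast
      ring
    · -- holomorphy
      obtain ⟨hsreg, -, -, -⟩ := hreg s hs
      obtain ⟨hL0, hL0', -, -⟩ := hoff s hsreg
      have h1 : DifferentiableAt ℂ (fun z ↦ (χ.LFunction z)⁻¹) s := (hLd s).inv hL0
      have h2 : DifferentiableAt ℂ (fun z ↦ (χ⁻¹.LFunction z)⁻¹) s := (hLd' s).inv hL0'
      exact ((differentiable_riemannZeta₀ s).add
        (((h1.const_mul w).add (h2.const_mul _)).const_mul _)).differentiableWithinAt
    · -- the bound
      obtain ⟨hsreg, hζb, hlt, hlamℒ⟩ := hreg s hs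
      obtain ⟨-, -, hb1, hb2⟩ := hoff s hsreg
      set lt : ℝ := Real.log (|s.im| + 4) with hltdef
      set d : ℝ := ‖s - ((1 / 2 : ℝ) : ℂ)‖⁻¹ with hddef
      have hd0 : 0 ≤ d := inv_nonneg.2 (norm_nonneg _)
      have hw' : ‖conj w‖ ≤ 1 := by rwa [Complex.norm_conj]
      have hmain : ‖(lam / 2 : ℂ) * (w * (χ.LFunction s)⁻¹ + conj w * (χ⁻¹.LFunction s)⁻¹)‖ ≤ lt := by
        have hn : ‖(lam / 2 : ℂ)‖ = lam / 2 := by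
          rw [show (lam / 2 : ℂ) = ((lam / 2 : ℝ) : ℂ) by push_cast; ring, Complex.norm_real,
            Real.norm_of_nonneg (by positivity)]
        rw [norm_mul, hn]
        have h1 : ‖w * (χ.LFunction s)⁻¹‖ ≤ C₁ * (Real.log q + lt) := by
          rw [norm_mul]
          calc ‖w‖ * ‖(χ.LFunction s)⁻¹‖ ≤ 1 * (C₁ * (Real.log q + lt)) :=
                mul_le_mul hw hb1 (norm_nonneg _) zero_le_one
            _ = _ := one_mul _
        have h2 : ‖conj w * (χ⁻¹.LFunction s)⁻¹‖ ≤ C₁ * (Real.log q + lt) := by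
          rw [norm_mul]
          calc ‖conj w‖ * ‖(χ⁻¹.LFunction s)⁻¹‖ ≤ 1 * (C₁ * (Real.log q + lt)) :=
                mul_le_mul hw' hb2 (norm_nonneg _) zero_le_one
            _ = _ := one_mul _
        calc lam / 2 * ‖w * (χ.LFunction s)⁻¹ + conj w * (χ⁻¹.LFunction s)⁻¹‖
            ≤ lam / 2 * (C₁ * (Real.log q + lt) + C₁ * (Real.log q + lt)) :=
              mul_le_mul_of_nonneg_left ((norm_add_le _ _).trans (add_le_add h1 h2)) (by positivity)
          _ = lam * (C₁ * (Real.log q + lt)) := by ring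
          _ ≤ lt := hlamℒ
      have hlt5 := hpow5 lt hlt
      calc ‖F s‖ ≤ ‖riemannZeta₀ s‖ +
            ‖(lam / 2 : ℂ) * (w * (χ.LFunction s)⁻¹ + conj w * (χ⁻¹.LFunction s)⁻¹)‖ :=
            norm_add_le _ _
        _ ≤ Cζ * lt + lt := add_le_add hζb hmain
        _ ≤ (Cζ + 2) * lt * (1 + d) := by
            have h1 : 0 ≤ Cζ * lt * d := by positivity
            have h2 : 0 ≤ lt * d := by positivity
            nlinarith
        _ ≤ (Cζ + 2) * lt ^ 5 * (1 + d) := by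
            refine mul_le_mul_of_nonneg_right (mul_le_mul_of_nonneg_left hlt5 (by positivity)) ?_
            positivity

/-- **Both cases together** (principal and non-principal characters): absolute constants
`0 < c ≤ 1/2`, `K, C₀ ≥ 0` such that for every `q ≥ 1`, every character `χ` mod `q` and every
`|w| ≤ 1`, with `λ = 1/(K(log q + log 4) + 1)`, the sequence `1 + λ Re(w χ(n)) μ(n)` satisfies
`ExcPsiData · F c (C₀ q²) (log q) β α` for some `F, β, α`, where either `α = 0`, or `χ ≠ χ₀` is
quadratic and `β` is a real zero of `L(s, χ)` (`exists_excPsiData_twist`,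
`exists_excPsiData_principal`, and `ExcPsiData.weaken`). [cite: MontgomeryVaughan2007, §11.3 Exercise 7] -/
theorem exists_excPsiData_all :
    ∃ c : ℝ, 0 < c ∧ c ≤ 1 / 2 ∧ ∃ K : ℝ, 0 ≤ K ∧ ∃ C₀ : ℝ, 0 ≤ C₀ ∧
      ∀ (q : ℕ) [NeZero q] (χ : DirichletCharacter ℂ q) (w : ℂ), ‖w‖ ≤ 1 →
        ∃ (β α : ℝ) (F : ℂ → ℂ), (α = 0 ∨ (χ ≠ 1 ∧ χ ^ 2 = 1 ∧ χ.LFunction β = 0)) ∧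
          ExcPsiData
            (fun n : ℕ ↦ 1 + 1 / (K * (Real.log q + Real.log 4) + 1) *
              (w * χ (n : ZMod q) * (μ n : ℂ)).re)
            F c (C₀ * (q : ℝ) ^ 2) (Real.log q) β α := by
  obtain ⟨ca, hca, hca2, K, hK, Ca, hCa, htwist⟩ := exists_excPsiData_twist
  obtain ⟨cb, hcb, hcb2, Cb, hCb, hprinc⟩ := exists_excPsiData_principal
  refine ⟨min ca cb, lt_min hca hcb, (min_le_left _ _).trans hca2, K, hK, max Ca Cb,
    le_max_of_le_left hCa, fun q _ χ w hw ↦ ?_⟩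
  have hq1 : (1 : ℝ) ≤ q := by exact_mod_cast NeZero.one_le
  have hq2 : (1 : ℝ) ≤ (q : ℝ) ^ 2 := one_le_pow₀ hq1
  have hmin0 : 0 < min ca cb := lt_min hca hcb
  by_cases hχ : χ = 1
  · subst hχ
    have hℒ₀ : 0 ≤ K * (Real.log q + Real.log 4) := by
      have := PagePNT.one_le_ell0 q; positivity
    have hlam0 : 0 < 1 / (K * (Real.log q + Real.log 4) + 1) := by positivity
    have hlam1 : 1 / (K * (Real.log q + Real.log 4) + 1) ≤ 1 := by
      rw [div_le_one (by positivity)]; linarith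
    obtain ⟨F, hF⟩ := hprinc q w hw _ hlam0 hlam1
    refine ⟨1 / 2, 0, F, Or.inl rfl, hF.weaken hmin0 (min_le_right _ _) ?_⟩
    exact mul_le_mul_of_nonneg_right (le_max_right _ _) (by positivity)
  · obtain ⟨β, α, F, hcase, hF⟩ := htwist q χ hχ w hw
    refine ⟨β, α, F, ?_, hF.weaken hmin0 (min_le_left _ _) ?_⟩
    · rcases hcase with h | ⟨h1, h2⟩
      · exact Or.inl h
      · exact Or.inr ⟨hχ, h1, h2⟩
    · calc Ca ≤ max Ca Cb := le_max_left _ _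
        _ = max Ca Cb * 1 := (mul_one _).symm
        _ ≤ max Ca Cb * (q : ℝ) ^ 2 := mul_le_mul_of_nonneg_left hq2 (le_max_of_le_left hCa)

end MoebiusTwist

end Literature.NumberTheory.LFunctions
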